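import Literature.Analysis.UnboundedOperators.LinearizedBoltzmannGainPointwise
import Literature.MathematicalPhysics.KineticTheory.HardSphereGainExchange
import Literature.Analysis.UnboundedOperators.LinearizedBoltzmannGaussGrowth
import HarnessLib

/-!
# The kernel action of the linearised hard-sphere operator in `ℝ³`: domination and a.e.-classes

Sibling proof file of `LinearizedBoltzmannKernelAction.lean` towards the everywhere-defined
representative of `L⁻¹ g` (Chapman–Enskog; CIP 1994 §7.2). For the iterated kernel integral
`(K ψ)(v) = ∫∫ ((v - v_*)·ω)₊ (ψ(v') + ψ(v_*') - ψ(v_*)) dω dM(v_*)` we prove: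

* `enorm_kernelAction_le_add` — domination by the three absolute gain/loss integrals (any `d`);
* `lintegral_stdGaussian_kernel_eq_volume`, `lintegral_loss_enorm_le` — bookkeeping of the
  Maxwellian density and the Cauchy–Schwarz bound of the loss integral (any `d`);
* `integrable_kernel_mul_comp_of_gaussGrowth`, `kernelAction_eq_pieces_of_gaussGrowth` — the
  splitting `K ψ = ∫∫ B ψ' + ∫∫ B ψ_*' - ∫∫ B ψ_*` for `ψ` of Gaussian growth (any `d`);
* `inv_sqrt_globalMaxwellian` — `(√M(v))⁻¹ = (√M(0))⁻¹ e^{|v|²/4}` in `ℝ³`;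
* `kernelAction_eq_of_ae_eq` — **in `ℝ³` the kernel action only depends on the Lebesgue-a.e.
  class of `ψ`, at every velocity**: the laws of `v'` and `v_*'` under `((v - v_*)·ω)₊ M(v_*) dω dv_*`
  are absolutely continuous (Carleman form `lintegral_gain_fst_eq_carleman` and the exchange
  symmetry `lintegral_lintegral_hardSphere_gain_exchange`).

No new definitions are introduced.
-/

open MeasureTheory Metric Real Set Filter Topology ProbabilityTheory Module
open scoped InnerProductSpace ENNReal

namespace Literature.Analysis.UnboundedOperators

noncomputable section

open Literature.MathematicalPhysics.KineticTheory (collide sphereMeasure hardSphereKernel carlemanKernel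
  gradRadial lintegral_lintegral_hardSphere_gain_exchange carlemanKernel_nonneg
  norm_sq_collide_fst_add_norm_sq_collide_snd)
open Literature.Analysis.FluidPDE

section GeneralE

variable {E : Type*} [NormedAddCommGroup E] [InnerProductSpace ℝ E] [FiniteDimensional ℝ E]
  [MeasurableSpace E] [BorelSpace E]

/-- The kernel action is dominated by the three absolute gain/loss integrals:
`|∫∫ B (ψ' + ψ_*' - ψ_*)| ≤ ∫∫ B |ψ'| + ∫∫ B |ψ_*'| + ∫∫ B |ψ_*|` (as `ℝ≥0∞`-integrals against
`dω dM_*`). [folklore] -/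
theorem enorm_kernelAction_le_add {ψ : E → ℝ} (hψ : Measurable ψ) (v : E) :
    ‖∫ w, ∫ ω, hardSphereKernel (v, w) ω * (ψ (collide ω (v, w)).1 + ψ (collide ω (v, w)).2 - ψ w)
        ∂sphereMeasure ∂stdGaussian E‖ₑ ≤
      (∫⁻ w, ∫⁻ ω, ENNReal.ofReal (hardSphereKernel (v, w) ω) * ‖ψ (collide ω (v, w)).1‖ₑ
          ∂sphereMeasure ∂stdGaussian E) +
        (∫⁻ w, ∫⁻ ω, ENNReal.ofReal (hardSphereKernel (v, w) ω) * ‖ψ (collide ω (v, w)).2‖ₑ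
          ∂sphereMeasure ∂stdGaussian E) +
        ∫⁻ w, ∫⁻ ω, ENNReal.ofReal (hardSphereKernel (v, w) ω) * ‖ψ w‖ₑ
          ∂sphereMeasure ∂stdGaussian E := by
  have hBm : Measurable fun p : E × sphere (0 : E) 1 => ENNReal.ofReal (hardSphereKernel (v, p.1) p.2) := by
    have : Continuous fun p : E × sphere (0 : E) 1 => hardSphereKernel (v, p.1) p.2 := by
      unfold hardSphereKernel; fun_prop
    exact this.measurable.ennreal_ofReal
  have hc1 : Measurable fun p : E × sphere (0 : E) 1 => (collide p.2 (v, p.1)).1 := by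
    have : Continuous fun p : E × sphere (0 : E) 1 => (collide p.2 (v, p.1)).1 := by
      unfold collide; fun_prop
    exact this.measurable
  have hc2 : Measurable fun p : E × sphere (0 : E) 1 => (collide p.2 (v, p.1)).2 := by
    have : Continuous fun p : E × sphere (0 : E) 1 => (collide p.2 (v, p.1)).2 := by
      unfold collide; fun_prop
    exact this.measurable
  have m1 : Measurable fun p : E × sphere (0 : E) 1 =>
      ENNReal.ofReal (hardSphereKernel (v, p.1) p.2) * ‖ψ (collide p.2 (v, p.1)).1‖ₑ :=
    hBm.mul (hψ.comp hc1).enorm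
  have m2 : Measurable fun p : E × sphere (0 : E) 1 =>
      ENNReal.ofReal (hardSphereKernel (v, p.1) p.2) * ‖ψ (collide p.2 (v, p.1)).2‖ₑ :=
    hBm.mul (hψ.comp hc2).enorm
  have m3 : Measurable fun p : E × sphere (0 : E) 1 =>
      ENNReal.ofReal (hardSphereKernel (v, p.1) p.2) * ‖ψ p.1‖ₑ :=
    hBm.mul (hψ.comp measurable_fst).enorm
  rw [← lintegral_add_left (show Measurable (fun w : E => ∫⁻ ω, ENNReal.ofReal (hardSphereKernel (v, w) ω) *
      ‖ψ (collide ω (v, w)).1‖ₑ ∂(sphereMeasure : Measure (sphere (0 : E) 1))) from m1.lintegral_prod_right'),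
    ← lintegral_add_left (show Measurable (fun w : E => (∫⁻ ω, ENNReal.ofReal (hardSphereKernel (v, w) ω) *
      ‖ψ (collide ω (v, w)).1‖ₑ ∂(sphereMeasure : Measure (sphere (0 : E) 1))) +
        ∫⁻ ω, ENNReal.ofReal (hardSphereKernel (v, w) ω) * ‖ψ (collide ω (v, w)).2‖ₑ
          ∂(sphereMeasure : Measure (sphere (0 : E) 1))) from
      m1.lintegral_prod_right'.add m2.lintegral_prod_right')]
  refine (enorm_integral_le_lintegral_enorm _).trans (lintegral_mono fun w => ?_)
  rw [← lintegral_add_left (show Measurable (fun ω : sphere (0 : E) 1 =>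
      ENNReal.ofReal (hardSphereKernel (v, w) ω) * ‖ψ (collide ω (v, w)).1‖ₑ) from m1.comp measurable_prodMk_left),
    ← lintegral_add_left (show Measurable (fun ω : sphere (0 : E) 1 =>
      ENNReal.ofReal (hardSphereKernel (v, w) ω) * ‖ψ (collide ω (v, w)).1‖ₑ +
        ENNReal.ofReal (hardSphereKernel (v, w) ω) * ‖ψ (collide ω (v, w)).2‖ₑ) from
      (m1.comp measurable_prodMk_left).add (m2.comp measurable_prodMk_left))]
  refine (enorm_integral_le_lintegral_enorm _).trans (lintegral_mono fun ω => ?_)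
  rw [enorm_mul, Real.enorm_eq_ofReal (show 0 ≤ hardSphereKernel (v, w) ω from le_max_right _ _),
    ← mul_add, ← mul_add]
  refine mul_le_mul' le_rfl ?_
  exact (enorm_sub_le).trans (add_le_add (enorm_add_le _ _) le_rfl)

/-- Absorbing the Maxwellian density into the kernel: `∫ (∫ B · U dω) dM(w) = ∫∫ (B M(w)) U dω dw`.
[folklore] -/
theorem lintegral_stdGaussian_kernel_eq_volume {U : E × sphere (0 : E) 1 → ℝ≥0∞} (hU : Measurable U)
    (v : E) :
    ∫⁻ w, ∫⁻ ω, ENNReal.ofReal (hardSphereKernel (v, w) ω) * U (w, ω) ∂sphereMeasure ∂stdGaussian E =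
      ∫⁻ w, ∫⁻ ω, ENNReal.ofReal (hardSphereKernel (v, w) ω * globalMaxwellian w) * U (w, ω)
        ∂sphereMeasure := by
  have hM : Measurable fun v : E => ENNReal.ofReal (globalMaxwellian v) :=
    continuous_globalMaxwellian.measurable.ennreal_ofReal
  have hBm : Measurable fun p : E × sphere (0 : E) 1 => ENNReal.ofReal (hardSphereKernel (v, p.1) p.2) := by
    have : Continuous fun p : E × sphere (0 : E) 1 => hardSphereKernel (v, p.1) p.2 := by
      unfold hardSphereKernel; fun_prop
    exact this.measurable.ennreal_ofReal
  have hF : Measurable fun p : E × sphere (0 : E) 1 =>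
      ENNReal.ofReal (hardSphereKernel (v, p.1) p.2) * U p := hBm.mul hU
  rw [stdGaussian_eq_withDensity_globalMaxwellian_holds,
    lintegral_withDensity_eq_lintegral_mul _ hM hF.lintegral_prod_right']
  refine lintegral_congr fun w => ?_
  simp only [Pi.mul_apply]
  rw [← lintegral_const_mul _ (show Measurable (fun ω : sphere (0 : E) 1 =>
      ENNReal.ofReal (hardSphereKernel (v, w) ω) * U (w, ω)) from hF.comp measurable_prodMk_left)]
  refine lintegral_congr fun ω => ?_
  rw [ENNReal.ofReal_mul (show 0 ≤ hardSphereKernel (v, w) ω from le_max_right _ _)]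
  ring

/-- The loss part of the dominating integral: `∫ (∫ ((v - w)·ω)₊ dω) |u(w)| dM(w)
≤ σ(S) (1 + |v|) (∫ (1 + |w|)² dM)^{1/2} ‖u‖_{L²(M)}` (Cauchy–Schwarz in `L²(M dw)`). [folklore] -/
theorem lintegral_loss_enorm_le {u : E → ℝ} (hum : Measurable u) (v : E) :
    ∫⁻ w, ∫⁻ ω, ENNReal.ofReal (hardSphereKernel (v, w) ω) * ‖u w‖ₑ ∂sphereMeasure ∂stdGaussian E ≤
      ENNReal.ofReal ((sphereMeasure : Measure (sphere (0 : E) 1)).real univ * (1 + ‖v‖)) *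
        ((∫⁻ w, ENNReal.ofReal ((1 + ‖w‖) ^ 2) ∂stdGaussian E) ^ (1 / 2 : ℝ) *
          eLpNorm u 2 (stdGaussian E)) := by
  haveI := isFiniteMeasure_sphereMeasure (E := E)
  set S : ℝ := (sphereMeasure : Measure (sphere (0 : E) 1)).real univ with hS
  have hS0 : 0 ≤ S := measureReal_nonneg
  -- the sphere integral of the kernel
  have hsph : ∀ w, ∫⁻ ω, ENNReal.ofReal (hardSphereKernel (v, w) ω) ∂sphereMeasure ≤
      ENNReal.ofReal (S * (1 + ‖v‖) * (1 + ‖w‖)) := by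
    intro w
    have hint : Integrable (fun ω : sphere (0 : E) 1 => hardSphereKernel (v, w) ω) sphereMeasure :=
      (integrable_const (‖v‖ + ‖w‖)).mono'
        ((by unfold hardSphereKernel; fun_prop : Continuous fun ω : sphere (0 : E) 1 =>
          hardSphereKernel (v, w) ω).aestronglyMeasurable)
        (Eventually.of_forall fun ω => by
          rw [Real.norm_eq_abs, abs_of_nonneg (le_max_right _ _)]
          exact (hardSphereKernel_le_abs_inner_add_norm v w ω).trans
            (add_le_add (abs_inner_sphere_le v ω) le_rfl))
    rw [← ofReal_integral_eq_lintegral_ofReal hint (Eventually.of_forall fun ω => le_max_right _ _)]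
    refine ENNReal.ofReal_le_ofReal ((sphereIntegral_hardSphereKernel_le v w).trans ?_)
    rw [← hS]
    nlinarith [norm_nonneg v, norm_nonneg w, mul_nonneg hS0 (mul_nonneg (norm_nonneg v) (norm_nonneg w)),
      mul_nonneg hS0 (norm_nonneg v), mul_nonneg hS0 (norm_nonneg w)]
  have hBm : Measurable fun p : E × sphere (0 : E) 1 => ENNReal.ofReal (hardSphereKernel (v, p.1) p.2) := by
    have : Continuous fun p : E × sphere (0 : E) 1 => hardSphereKernel (v, p.1) p.2 := by
      unfold hardSphereKernel; fun_prop
    exact this.measurable.ennreal_ofReal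
  -- pull `|u(w)|` out of the sphere integral and apply Cauchy–Schwarz
  have h1 : ∀ w, ∫⁻ ω, ENNReal.ofReal (hardSphereKernel (v, w) ω) * ‖u w‖ₑ ∂sphereMeasure ≤
      ENNReal.ofReal (S * (1 + ‖v‖)) * (ENNReal.ofReal (1 + ‖w‖) * ‖u w‖ₑ) := by
    intro w
    rw [lintegral_mul_const _ (show Measurable (fun ω : sphere (0 : E) 1 =>
        ENNReal.ofReal (hardSphereKernel (v, w) ω)) from hBm.comp measurable_prodMk_left), ← mul_assoc,
      ← ENNReal.ofReal_mul (by positivity)]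
    exact mul_le_mul' (hsph w) le_rfl
  refine (lintegral_mono h1).trans ?_
  have hf : Measurable fun w : E => ENNReal.ofReal (1 + ‖w‖) := (measurable_const.add measurable_norm).ennreal_ofReal
  have hg : Measurable fun w : E => ‖u w‖ₑ := hum.enorm
  rw [lintegral_const_mul _ (show Measurable (fun w : E => ENNReal.ofReal (1 + ‖w‖) * ‖u w‖ₑ) from hf.mul hg)]
  refine mul_le_mul' le_rfl ?_
  have hCS := ENNReal.lintegral_mul_le_Lp_mul_Lq (stdGaussian E) Real.HolderConjugate.two_two
    hf.aemeasurable hg.aemeasurable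
  refine hCS.trans (le_of_eq ?_)
  congr 2
  · refine lintegral_congr fun w => ?_
    rw [show ((2 : ℝ)) = ((2 : ℕ) : ℝ) by norm_num, ENNReal.rpow_natCast, ← ENNReal.ofReal_pow (by positivity)]
  · rw [eLpNorm_eq_lintegral_rpow_enorm_toReal two_ne_zero ENNReal.ofNat_ne_top, ENNReal.toReal_ofNat,
      one_div]


end GeneralE

/-! ### The three pieces of the kernel action under Gaussian growth (any `d`) -/

section Pieces

variable {E : Type*} [NormedAddCommGroup E] [InnerProductSpace ℝ E] [FiniteDimensional ℝ E]
  [MeasurableSpace E] [BorelSpace E]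

/-- Integrability of one piece `B ψ(P)` of the kernel integrand of a function of Gaussian growth,
for a transported velocity `P` with `|P|² ≤ |v|² + |v_*|²` (e.g. `v'`, `v_*'`, `v_*`). [folklore] -/
theorem integrable_kernel_mul_comp_of_gaussGrowth {ψ : E → ℝ} (hψ : Measurable ψ) {C : ℝ}
    (hC : ∀ x, |ψ x| ≤ C * Real.exp (‖x‖ ^ 2 / 4)) (v : E) {P : E × sphere (0 : E) 1 → E}
    (hPm : Measurable P) (hP : ∀ w ω, ‖P (w, ω)‖ ^ 2 ≤ ‖v‖ ^ 2 + ‖w‖ ^ 2) :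
    (∀ w, Integrable (fun ω => hardSphereKernel (v, w) ω * ψ (P (w, ω)))
        (sphereMeasure : Measure (sphere (0 : E) 1))) ∧
      Integrable (fun w => ∫ ω, hardSphereKernel (v, w) ω * ψ (P (w, ω)) ∂sphereMeasure) (stdGaussian E) := by
  have hC0 : 0 ≤ C := by
    have h := hC 0
    rw [norm_zero] at h
    norm_num at h
    exact (abs_nonneg _).trans h
  have hB : Continuous fun p : E × sphere (0 : E) 1 => hardSphereKernel (v, p.1) p.2 := by
    unfold hardSphereKernel; fun_prop
  have hΦm : Measurable fun p : E × sphere (0 : E) 1 => hardSphereKernel (v, p.1) p.2 * ψ (P p) :=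
    hB.measurable.mul (hψ.comp hPm)
  have hbd : ∀ w ω, |hardSphereKernel (v, w) ω * ψ (P (w, ω))| ≤
      (C * ((1 + ‖v‖) * Real.exp (‖v‖ ^ 2 / 4))) * ((1 + ‖w‖) * Real.exp (‖w‖ ^ 2 / 4)) := by
    intro w ω
    have hB0 : 0 ≤ hardSphereKernel (v, w) ω := le_max_right _ _
    have hBle : hardSphereKernel (v, w) ω ≤ (1 + ‖v‖) * (1 + ‖w‖) := by
      refine (hardSphereKernel_le_abs_inner_add_norm v w ω).trans ?_
      nlinarith [abs_inner_sphere_le v ω, norm_nonneg v, norm_nonneg w,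
        mul_nonneg (norm_nonneg v) (norm_nonneg w)]
    have hexp : Real.exp (‖P (w, ω)‖ ^ 2 / 4) ≤ Real.exp (‖v‖ ^ 2 / 4) * Real.exp (‖w‖ ^ 2 / 4) := by
      rw [← Real.exp_add]; exact Real.exp_le_exp.2 (by linarith [hP w ω])
    rw [abs_mul, abs_of_nonneg hB0]
    calc hardSphereKernel (v, w) ω * |ψ (P (w, ω))|
        ≤ ((1 + ‖v‖) * (1 + ‖w‖)) * (C * (Real.exp (‖v‖ ^ 2 / 4) * Real.exp (‖w‖ ^ 2 / 4))) :=
          mul_le_mul hBle ((hC _).trans (mul_le_mul_of_nonneg_left hexp hC0)) (abs_nonneg _) (by positivity)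
      _ = _ := by ring
  exact ⟨fun w => integrable_sphere_section_of_bound hΦm hbd w,
    integrable_integral_sphere_of_gaussBound hΦm hbd⟩

/-- The kernel action of a function of Gaussian growth splits into its three pieces:
`∫∫ B (ψ' + ψ_*' - ψ_*) = ∫∫ B ψ' + ∫∫ B ψ_*' - ∫∫ B ψ_*`. [folklore] -/
theorem kernelAction_eq_pieces_of_gaussGrowth {ψ : E → ℝ} (hψ : Measurable ψ) {C : ℝ}
    (hC : ∀ x, |ψ x| ≤ C * Real.exp (‖x‖ ^ 2 / 4)) (v : E) :
    ∫ w, ∫ ω, hardSphereKernel (v, w) ω * (ψ (collide ω (v, w)).1 + ψ (collide ω (v, w)).2 - ψ w)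
        ∂sphereMeasure ∂stdGaussian E =
      (∫ w, ∫ ω, hardSphereKernel (v, w) ω * ψ (collide ω (v, w)).1 ∂sphereMeasure ∂stdGaussian E) +
        (∫ w, ∫ ω, hardSphereKernel (v, w) ω * ψ (collide ω (v, w)).2 ∂sphereMeasure ∂stdGaussian E) -
        ∫ w, ∫ ω, hardSphereKernel (v, w) ω * ψ w ∂sphereMeasure ∂stdGaussian E := by
  have hc1 : Measurable fun p : E × sphere (0 : E) 1 => (collide p.2 (v, p.1)).1 := by
    have : Continuous fun p : E × sphere (0 : E) 1 => (collide p.2 (v, p.1)).1 := by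
      unfold collide; fun_prop
    exact this.measurable
  have hc2 : Measurable fun p : E × sphere (0 : E) 1 => (collide p.2 (v, p.1)).2 := by
    have : Continuous fun p : E × sphere (0 : E) 1 => (collide p.2 (v, p.1)).2 := by
      unfold collide; fun_prop
    exact this.measurable
  have hP1 : ∀ w (ω : sphere (0 : E) 1), ‖(collide ω (v, w)).1‖ ^ 2 ≤ ‖v‖ ^ 2 + ‖w‖ ^ 2 := fun w ω => by
    have h := norm_sq_collide_fst_add_norm_sq_collide_snd ω (v, w)
    simp only at h; nlinarith [sq_nonneg ‖(collide ω (v, w)).2‖]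
  have hP2 : ∀ w (ω : sphere (0 : E) 1), ‖(collide ω (v, w)).2‖ ^ 2 ≤ ‖v‖ ^ 2 + ‖w‖ ^ 2 := fun w ω => by
    have h := norm_sq_collide_fst_add_norm_sq_collide_snd ω (v, w)
    simp only at h; nlinarith [sq_nonneg ‖(collide ω (v, w)).1‖]
  have hP3 : ∀ w (ω : sphere (0 : E) 1), ‖(fun p : E × sphere (0 : E) 1 => p.1) (w, ω)‖ ^ 2 ≤
      ‖v‖ ^ 2 + ‖w‖ ^ 2 := fun w ω => by
    simp only; nlinarith [sq_nonneg ‖v‖]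
  obtain ⟨i1, I1⟩ := integrable_kernel_mul_comp_of_gaussGrowth hψ hC v hc1 hP1
  obtain ⟨i2, I2⟩ := integrable_kernel_mul_comp_of_gaussGrowth hψ hC v hc2 hP2
  obtain ⟨i3, I3⟩ := integrable_kernel_mul_comp_of_gaussGrowth hψ hC v measurable_fst hP3
  have i1' : ∀ w, Integrable (fun ω => hardSphereKernel (v, w) ω * ψ (collide ω (v, w)).1)
      (sphereMeasure : Measure (sphere (0 : E) 1)) := i1
  have i2' : ∀ w, Integrable (fun ω => hardSphereKernel (v, w) ω * ψ (collide ω (v, w)).2)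
      (sphereMeasure : Measure (sphere (0 : E) 1)) := i2
  have i3' : ∀ w, Integrable (fun ω => hardSphereKernel (v, w) ω * ψ w)
      (sphereMeasure : Measure (sphere (0 : E) 1)) := i3
  have I1' : Integrable (fun w => ∫ ω, hardSphereKernel (v, w) ω * ψ (collide ω (v, w)).1 ∂sphereMeasure)
      (stdGaussian E) := I1
  have I2' : Integrable (fun w => ∫ ω, hardSphereKernel (v, w) ω * ψ (collide ω (v, w)).2 ∂sphereMeasure)
      (stdGaussian E) := I2
  have I3' : Integrable (fun w => ∫ ω, hardSphereKernel (v, w) ω * ψ w ∂sphereMeasure) (stdGaussian E) := I3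
  have hinner : ∀ w, ∫ ω, hardSphereKernel (v, w) ω * (ψ (collide ω (v, w)).1 + ψ (collide ω (v, w)).2 - ψ w)
      ∂sphereMeasure =
      (∫ ω, hardSphereKernel (v, w) ω * ψ (collide ω (v, w)).1 ∂sphereMeasure) +
        (∫ ω, hardSphereKernel (v, w) ω * ψ (collide ω (v, w)).2 ∂sphereMeasure) -
        ∫ ω, hardSphereKernel (v, w) ω * ψ w ∂sphereMeasure := by
    intro w
    rw [← integral_add (i1' w) (i2' w), ← integral_sub (show Integrable (fun ω =>
        hardSphereKernel (v, w) ω * ψ (collide ω (v, w)).1 + hardSphereKernel (v, w) ω * ψ (collide ω (v, w)).2)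
        (sphereMeasure : Measure (sphere (0 : E) 1)) from (i1' w).add (i2' w)) (i3' w)]
    refine integral_congr_ae (Eventually.of_forall fun ω => ?_)
    ring
  rw [integral_congr_ae (Eventually.of_forall hinner), integral_sub (show Integrable (fun w =>
      (∫ ω, hardSphereKernel (v, w) ω * ψ (collide ω (v, w)).1 ∂sphereMeasure) +
        ∫ ω, hardSphereKernel (v, w) ω * ψ (collide ω (v, w)).2 ∂sphereMeasure) (stdGaussian E) from
      I1'.add I2') I3', integral_add I1' I2']

end Pieces

/-! ### The Maxwellian weight in `ℝ³` -/

/-- `(√M(v))⁻¹ = (√M(0))⁻¹ e^{|v|²/4}`. [folklore] -/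
theorem inv_sqrt_globalMaxwellian (v : EuclideanSpace ℝ (Fin 3)) :
    (Real.sqrt (globalMaxwellian v))⁻¹ = (Real.sqrt (globalMaxwellian (0 : EuclideanSpace ℝ (Fin 3))))⁻¹ *
      Real.exp (‖v‖ ^ 2 / 4) := by
  have hfac : globalMaxwellian v = globalMaxwellian (0 : EuclideanSpace ℝ (Fin 3)) * Real.exp (-‖v‖ ^ 2 / 2) := by
    simp only [globalMaxwellian, norm_zero]
    norm_num
  rw [hfac, Real.sqrt_mul (globalMaxwellian_pos _).le, mul_inv]
  congr 1
  rw [show -‖v‖ ^ 2 / 2 = -(‖v‖ ^ 2 / 2) by ring, Real.exp_neg, Real.sqrt_inv, inv_inv,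
    ← Real.exp_half]
  congr 1
  ring

/-! ### The kernel action only sees Lebesgue-a.e. classes, at every velocity (`ℝ³`) -/

/-- In `ℝ³`, if `Δ = 0` Lebesgue-a.e. then `∫∫ ((v - v_*)·ω)₊ M(v_*) |Δ(v')| dω dv_* = 0` for **every**
`v` (Carleman form: the law of `v'` under `((v - v_*)·ω)₊ M(v_*) dω dv_*` has the density `k(v, ·)`).
[folklore] -/
theorem lintegral_gain_fst_enorm_eq_zero_of_ae_eq_zero (v : EuclideanSpace ℝ (Fin 3))
    {Δ : EuclideanSpace ℝ (Fin 3) → ℝ} (hΔm : Measurable Δ) (hΔ : Δ =ᵐ[volume] 0) :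
    ∫⁻ w, ∫⁻ ω, ENNReal.ofReal (hardSphereKernel (v, w) ω * globalMaxwellian w) *
        ‖Δ (collide ω (v, w)).1‖ₑ ∂sphereMeasure = 0 := by
  rw [lintegral_gain_fst_eq_carleman v hΔm.enorm]
  have h : (fun u : EuclideanSpace ℝ (Fin 3) => Δ (v + u)) =ᵐ[volume] fun _ => (0 : ℝ) :=
    (measurePreserving_add_left volume v).quasiMeasurePreserving.ae_eq hΔ
  refine (lintegral_congr_ae ?_).trans lintegral_zero
  filter_upwards [h] with u hu
  simp [hu]

/-- From `∫∫ ((v - v_*)·ω)₊ M(v_*) |Δ(φ)| dω dv_* = 0` to `((v - v_*)·ω)₊ Δ(φ) = 0` for `M dv_*`-a.e.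
`v_*` and `σ`-a.e. `ω`. [folklore] -/
theorem ae_ae_kernel_mul_eq_zero (v : EuclideanSpace ℝ (Fin 3))
    {Δ : EuclideanSpace ℝ (Fin 3) → ℝ} (hΔm : Measurable Δ)
    {φ : EuclideanSpace ℝ (Fin 3) × sphere (0 : EuclideanSpace ℝ (Fin 3)) 1 → EuclideanSpace ℝ (Fin 3)}
    (hφ : Measurable φ)
    (h0 : ∫⁻ w, ∫⁻ ω, ENNReal.ofReal (hardSphereKernel (v, w) ω * globalMaxwellian w) *
        ‖Δ (φ (w, ω))‖ₑ ∂sphereMeasure = 0) :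
    ∀ᵐ w ∂stdGaussian (EuclideanSpace ℝ (Fin 3)), ∀ᵐ ω ∂(sphereMeasure : Measure
      (sphere (0 : EuclideanSpace ℝ (Fin 3)) 1)), hardSphereKernel (v, w) ω * Δ (φ (w, ω)) = 0 := by
  have hBm : Measurable fun p : EuclideanSpace ℝ (Fin 3) × sphere (0 : EuclideanSpace ℝ (Fin 3)) 1 =>
      hardSphereKernel (v, p.1) p.2 := by
    have : Continuous fun p : EuclideanSpace ℝ (Fin 3) × sphere (0 : EuclideanSpace ℝ (Fin 3)) 1 =>
        hardSphereKernel (v, p.1) p.2 := by unfold hardSphereKernel; fun_prop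
    exact this.measurable
  have hF : Measurable fun p : EuclideanSpace ℝ (Fin 3) × sphere (0 : EuclideanSpace ℝ (Fin 3)) 1 =>
      ENNReal.ofReal (hardSphereKernel (v, p.1) p.2 * globalMaxwellian p.1) * ‖Δ (φ p)‖ₑ :=
    (hBm.mul (continuous_globalMaxwellian.measurable.comp measurable_fst)).ennreal_ofReal.mul
      (hΔm.comp hφ).enorm
  have h1 : ∀ᵐ w ∂(volume : Measure (EuclideanSpace ℝ (Fin 3))), ∫⁻ ω, ENNReal.ofReal
      (hardSphereKernel (v, w) ω * globalMaxwellian w) * ‖Δ (φ (w, ω))‖ₑ ∂sphereMeasure = 0 :=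
    (lintegral_eq_zero_iff hF.lintegral_prod_right').1 h0
  have h2 : ∀ᵐ w ∂stdGaussian (EuclideanSpace ℝ (Fin 3)), ∫⁻ ω, ENNReal.ofReal
      (hardSphereKernel (v, w) ω * globalMaxwellian w) * ‖Δ (φ (w, ω))‖ₑ ∂sphereMeasure = 0 := by
    rw [stdGaussian_eq_withDensity_globalMaxwellian_holds]
    exact (withDensity_absolutelyContinuous _ _) h1
  filter_upwards [h2] with w hw
  have hw' := (lintegral_eq_zero_iff (hF.comp measurable_prodMk_left)).1 hw
  filter_upwards [hw'] with ω hω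
  simp only [Function.comp_apply, Pi.zero_apply, mul_eq_zero, ENNReal.ofReal_eq_zero,
    enorm_eq_zero] at hω
  rcases hω with hω | hω
  · have hB0 : 0 ≤ hardSphereKernel (v, w) ω := le_max_right _ _
    have hM := globalMaxwellian_pos w
    have : hardSphereKernel (v, w) ω = 0 := by nlinarith [mul_nonneg hB0 hM.le]
    rw [this, zero_mul]
  · rw [hω, mul_zero]

/-- **The kernel action of the linearised hard-sphere operator in `ℝ³` only depends on the
Lebesgue-a.e. class of its argument, at every velocity**: if `ψ₁ = ψ₂` a.e. (both measurable) then
`∫∫ B (ψ₁' + ψ₁,*' - ψ₁,*) dω dM_* (v) = ∫∫ B (ψ₂' + ψ₂,*' - ψ₂,*) dω dM_* (v)` for **every** `v`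
(the laws of `v'`, `v_*'` under `B M_* dω dv_*` are absolutely continuous: Carleman form and the
exchange symmetry `lintegral_lintegral_hardSphere_gain_exchange`). [folklore] -/
theorem kernelAction_eq_of_ae_eq {ψ₁ ψ₂ : EuclideanSpace ℝ (Fin 3) → ℝ} (h₁ : Measurable ψ₁)
    (h₂ : Measurable ψ₂) (h : ψ₁ =ᵐ[volume] ψ₂) (v : EuclideanSpace ℝ (Fin 3)) :
    (∫ w, ∫ ω, hardSphereKernel (v, w) ω * (ψ₁ (collide ω (v, w)).1 + ψ₁ (collide ω (v, w)).2 - ψ₁ w)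
        ∂sphereMeasure ∂stdGaussian (EuclideanSpace ℝ (Fin 3))) =
      ∫ w, ∫ ω, hardSphereKernel (v, w) ω * (ψ₂ (collide ω (v, w)).1 + ψ₂ (collide ω (v, w)).2 - ψ₂ w)
        ∂sphereMeasure ∂stdGaussian (EuclideanSpace ℝ (Fin 3)) := by
  set Δ : EuclideanSpace ℝ (Fin 3) → ℝ := fun x => ψ₁ x - ψ₂ x with hΔ
  have hΔm : Measurable Δ := h₁.sub h₂
  have hΔ0 : Δ =ᵐ[volume] 0 := by
    filter_upwards [h] with x hx
    simp [hΔ, hx]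
  have hc1 : Measurable fun p : EuclideanSpace ℝ (Fin 3) × sphere (0 : EuclideanSpace ℝ (Fin 3)) 1 =>
      (collide p.2 (v, p.1)).1 := by
    have : Continuous fun p : EuclideanSpace ℝ (Fin 3) × sphere (0 : EuclideanSpace ℝ (Fin 3)) 1 =>
        (collide p.2 (v, p.1)).1 := by unfold collide; fun_prop
    exact this.measurable
  have hc2 : Measurable fun p : EuclideanSpace ℝ (Fin 3) × sphere (0 : EuclideanSpace ℝ (Fin 3)) 1 =>
      (collide p.2 (v, p.1)).2 := by
    have : Continuous fun p : EuclideanSpace ℝ (Fin 3) × sphere (0 : EuclideanSpace ℝ (Fin 3)) 1 =>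
        (collide p.2 (v, p.1)).2 := by unfold collide; fun_prop
    exact this.measurable
  -- the two gain laws do not charge `{Δ ≠ 0}`
  have hT1 := lintegral_gain_fst_enorm_eq_zero_of_ae_eq_zero v hΔm hΔ0
  have hT2 : ∫⁻ w, ∫⁻ ω, ENNReal.ofReal (hardSphereKernel (v, w) ω * globalMaxwellian w) *
      ‖Δ (collide ω (v, w)).2‖ₑ ∂sphereMeasure = 0 := by
    rw [lintegral_lintegral_hardSphere_gain_exchange v globalMaxwellian volume hΔm.enorm]
    exact hT1
  have hA1 := ae_ae_kernel_mul_eq_zero v hΔm hc1 hT1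
  have hA2 := ae_ae_kernel_mul_eq_zero v hΔm hc2 hT2
  have hA3 : ∀ᵐ w ∂stdGaussian (EuclideanSpace ℝ (Fin 3)), Δ w = 0 := by
    rw [stdGaussian_eq_withDensity_globalMaxwellian_holds]
    exact (withDensity_absolutelyContinuous _ _) hΔ0
  refine integral_congr_ae ?_
  filter_upwards [hA1, hA2, hA3] with w hw1 hw2 hw3
  refine integral_congr_ae ?_
  filter_upwards [hw1, hw2] with ω hω1 hω2
  simp only [hΔ] at hω1 hω2 hw3
  linear_combination hω1 + hω2 - hardSphereKernel (v, w) ω * hw3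


end

end Literature.Analysis.UnboundedOperators
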